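import Summits.Ventures.PercRepro.SixFourPLKinds

/-!
# PercRepro — C-025 at `(6,4)`, §22.12.2 (b)–(c): the planes of the third kind and their number (p3, gen 10)

For a normalisation `D : PLData M G` of a plane-line set, the planes of `M` with a rank-`3` trace other than `P₀`
and the `Π_y` have trace `{x} ∪ λ` with `x ∈ L` and `λ = P ∩ ρ` a non-class line trace of `ρ`
(`plane_trichotomy`, `third_spec`).  This file computes their line profile and counts them:
* `inc_third`: the only line with `≥ 3` points of `{x} ∪ λ` is `cl(λ)`: `inc M (P ∩ G) m = [m = |λ|]` for `m ≥ 3`;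
* `nclTraces m`, the non-class line traces of `ρ` with `m` points, and `card_nclTraces_le`: there are at most
  `ν_m(π) = inc_m − #{j : s_j = m}` of them (`λ ↦ cl(λ)` is injective from the non-class traces and the classes with
  `m` points into the lines meeting `ρ` in `m` points, 22.12.2 (c));
* `thirdPlanes m`, the planes of the third kind with `|P ∩ ρ| = m`, and `card_thirdPlanes_le`: there are at most
  `n·ν_m(π)` of them (`P = cl({x} ∪ (P ∩ ρ))`, so `P ↦ (x, P ∩ ρ)` is injective into `L × nclTraces m`).
-/

namespace PercRepro.SixFour

open Finset ThmH

variable {α : Type*} [DecidableEq α] {M : Matroid α} [M.Finite] {G : Finset α}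

namespace PLData

variable {D : PLData M G}

/-! ## The planes of the third kind -/

/-- For a plane `P`, `cl(P ∩ ρ)` meets `ρ` exactly in `P ∩ ρ`. -/
theorem clF_inter_ρ_eq (hG : G ⊆ gr M) {P : Finset α} (hP : P ∈ planes M) :
    clF M (P ∩ D.ρ) ∩ D.ρ = P ∩ D.ρ := by
  apply Finset.Subset.antisymm
  · intro z hz
    rw [Finset.mem_inter] at hz ⊢
    exact ⟨clF_subset_of_subset_plane hP Finset.inter_subset_left hz.1, hz.2⟩
  · intro z hz
    rw [Finset.mem_inter]
    refine ⟨?_, (Finset.mem_inter.1 hz).2⟩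
    rw [← Finset.mem_coe, coe_clF]
    exact M.subset_closure ((P ∩ D.ρ : Finset α) : Set α)
      (by rw [← coe_gr M]; exact Finset.coe_subset.2 (Finset.inter_subset_right.trans (D.ρ_subset.trans hG))) hz

/-- `x ∈ L` is not in `ρ`. -/
theorem notMem_ρ_of_mem_L {x : α} (hx : x ∈ D.L) : x ∉ D.ρ := by
  intro h
  have hx' := hx
  unfold L at hx'
  unfold ρ at h
  exact (Finset.mem_sdiff.1 hx').2 (Finset.mem_inter.1 h).1

/-- **The line profile of a plane of the third kind (22.12.2 (b))**: when `P ∩ G = {x} ∪ (P ∩ ρ)` with `x ∈ L` and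
`ρ(P ∩ ρ) = 2`, the only line with `≥ 3` points of the trace is `cl(P ∩ ρ)`:
`inc M (P ∩ G) m = [m = |P ∩ ρ|]` for `m ≥ 3`. -/
theorem inc_third (hs : Simple M) (hG : G ⊆ gr M) (h2 : 2 ≤ D.L.card) {P : Finset α} {x : α}
    (hx : x ∈ D.L) (htr : P ∩ G = insert x (P ∩ D.ρ)) (hr2 : M.eRk ((P ∩ D.ρ : Finset α) : Set α) = 2) {m : ℕ}
    (hm : 3 ≤ m) : inc M (P ∩ G) m = if m = (P ∩ D.ρ).card then 1 else 0 := by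
  have hxρ : x ∉ D.ρ := notMem_ρ_of_mem_L hx
  have hlG : P ∩ D.ρ ⊆ gr M := Finset.inter_subset_right.trans (D.ρ_subset.trans hG)
  have hLc := clF_mem_lines hlG hr2
  -- `cl(P ∩ ρ) ∩ (P ∩ G) = P ∩ ρ`
  have hLcT : clF M (P ∩ D.ρ) ∩ (P ∩ G) = P ∩ D.ρ := by
    rw [htr]
    apply Finset.Subset.antisymm
    · intro z hz
      rw [Finset.mem_inter, Finset.mem_insert] at hz
      rcases hz with ⟨hzc, hzx | hzl⟩
      · exfalso
        rw [hzx] at hzc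
        have hxP₀ : x ∈ D.P₀ :=
          clF_subset_of_subset_plane D.plane (Finset.inter_subset_right.trans (ρ_subset_P₀ (D := D))) hzc
        apply hxρ
        unfold ρ
        exact Finset.mem_inter.2 ⟨hxP₀, D.L_subset hx⟩
      · exact hzl
    · intro z hz
      exact Finset.mem_inter.2 ⟨hLc.2 hz, Finset.mem_insert_of_mem hz⟩
  have hℓρ : (D.ellF ∩ D.ρ).card ≤ 1 :=
    (Finset.card_le_card (Finset.inter_subset_inter (Finset.Subset.refl _) (ρ_subset_P₀ (D := D)))).trans
      (D.card_ellF_inter_le_one hs hG h2)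
  unfold inc
  have hF : (lines M).filter (fun L' : Finset α => (L' ∩ (P ∩ G)).card = m) =
      ({clF M (P ∩ D.ρ)} : Finset (Finset α)).filter (fun L' : Finset α => (L' ∩ (P ∩ G)).card = m) := by
    ext L'
    simp only [Finset.mem_filter, Finset.mem_singleton]
    constructor
    · rintro ⟨hL', hc⟩
      refine ⟨?_, hc⟩
      have h3G : 3 ≤ (L' ∩ G).card := by
        have := Finset.card_le_card
          (Finset.inter_subset_inter (Finset.Subset.refl L') (Finset.inter_subset_right : P ∩ G ⊆ G))
        omega
      rcases line_trichotomy (D := D) hs hG hL' h3G with hℓ | hρ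
      · -- `ℓ` has at most two points of `{x} ∪ (P ∩ ρ)`
        exfalso
        subst hℓ
        have hsub : D.ellF ∩ (P ∩ G) ⊆ insert x (D.ellF ∩ D.ρ) := by
          rw [htr]
          intro z hz
          rw [Finset.mem_inter, Finset.mem_insert] at hz
          rw [Finset.mem_insert]
          rcases hz.2 with rfl | hzl
          · exact Or.inl rfl
          · exact Or.inr (Finset.mem_inter.2 ⟨hz.1, (Finset.mem_inter.1 hzl).2⟩)
        have := (Finset.card_le_card hsub).trans (Finset.card_insert_le _ _)
        omega
      · -- `L′ ∩ G ⊆ ρ`: `x ∉ L′`, so `L′` meets the trace inside `P ∩ ρ`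
        have hTeq : L' ∩ (P ∩ G) = L' ∩ (P ∩ D.ρ) := by
          rw [htr]
          ext z
          simp only [Finset.mem_inter, Finset.mem_insert]
          constructor
          · rintro ⟨hzL', rfl | hzl⟩
            · exfalso
              exact hxρ (hρ (Finset.mem_inter.2 ⟨hzL', D.L_subset hx⟩))
            · exact ⟨hzL', hzl⟩
          · rintro ⟨hzL', hzl⟩
            exact ⟨hzL', Or.inr hzl⟩
        rw [hTeq] at hc
        exact (subset_line_of_two_le_inter hs hL' hlG hr2.le (by omega)).2
    · rintro ⟨rfl, hc⟩
      exact ⟨hLc.1, hc⟩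
  rw [hF, Finset.filter_singleton, hLcT]
  by_cases h : m = (P ∩ D.ρ).card
  · rw [if_pos h.symm, if_pos h, Finset.card_singleton]
  · rw [if_neg (Ne.symm h), if_neg h, Finset.card_empty]

/-! ## Counting the planes of the third kind -/

/-- The non-class line traces of `ρ` with `m` points. -/
noncomputable def nclTraces (D : PLData M G) (m : ℕ) : Finset (Finset α) :=
  ((lines M).image fun L' => L' ∩ D.ρ).filter fun l => l.card = m ∧ l ∉ D.classes

/-- `#{non-class line traces with m points} + #{classes with m points} ≤ inc_m` for `m ≥ 2`: `λ ↦ cl(λ)` is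
injective into the lines meeting `ρ` in `m` points. -/
theorem card_nclTraces_add_le (hs : Simple M) (hG : G ⊆ gr M) (h2 : 2 ≤ D.L.card) {m : ℕ} (hm : 2 ≤ m) :
    (D.nclTraces m).card + (D.classes.filter fun C => m = C.card).card ≤ inc M D.ρ m := by
  have hkey : ∀ l ∈ D.nclTraces m ∪ D.classes.filter (fun C => m = C.card),
      clF M l ∈ lines M ∧ clF M l ∩ D.ρ = l ∧ l.card = m := by
    intro l hl
    rw [Finset.mem_union] at hl
    rcases hl with hl | hl
    · obtain ⟨hmem, hcard, -⟩ := Finset.mem_filter.1 hl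
      obtain ⟨L', hL', rfl⟩ := Finset.mem_image.1 hmem
      have hcl : clF M (L' ∩ D.ρ) = L' := clF_eq_of_subset_line hs hL' Finset.inter_subset_left (by omega)
      exact ⟨by rw [hcl]; exact hL', by rw [hcl], hcard⟩
    · obtain ⟨hC, hcard⟩ := Finset.mem_filter.1 hl
      obtain ⟨hLc, htr⟩ := class_line hs hG h2 hC (by omega)
      exact ⟨hLc, htr, hcard.symm⟩
  have hdisj : Disjoint (D.nclTraces m) (D.classes.filter fun C => m = C.card) := by
    rw [Finset.disjoint_left]
    intro l hl hl'
    exact (Finset.mem_filter.1 hl).2.2 (Finset.mem_filter.1 hl').1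
  rw [← Finset.card_union_of_disjoint hdisj]
  unfold inc
  refine Finset.card_le_card_of_injOn (fun l => clF M l) ?_ ?_
  · intro l hl
    rw [Finset.mem_coe] at hl
    obtain ⟨hLc, htr, hcard⟩ := hkey l hl
    rw [Finset.mem_coe, Finset.mem_filter, htr]
    exact ⟨hLc, hcard⟩
  · intro l hl l' hl' heq
    rw [Finset.mem_coe] at hl hl'
    obtain ⟨-, htr, -⟩ := hkey l hl
    obtain ⟨-, htr', -⟩ := hkey l' hl'
    simp only at heq
    rw [← htr, ← htr', heq]

/-- `inc_m` of the profile is `inc M ρ m` for `2 ≤ m ≤ 7`. -/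
theorem incOf_profile {m : ℕ} (h2 : 2 ≤ m) (h7 : m ≤ 7) : PL.incOf D.profile m = inc M D.ρ m := by
  unfold PL.incOf
  rw [if_pos h2, inc_profile (m - 2) (by omega), show m - 2 + 2 = m by omega]

/-- **`#nclTraces m ≤ ν_m(π)`** for `2 ≤ m ≤ 7` (22.12.2 (c)). -/
theorem card_nclTraces_le (hs : Simple M) (hG : G ⊆ gr M) (hpl : ∀ P ∈ planes M, (P ∩ G).card ≤ 7)
    (hg : 10 ≤ G.card) {m : ℕ} (hm : 2 ≤ m) (hm7 : m ≤ 7) : (D.nclTraces m).card ≤ PL.nu D.profile m := by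
  have h2 : 2 ≤ D.L.card := by have := D.three_le_card_L (hpl _ D.plane) hg; omega
  unfold PL.nu
  rw [incOf_profile hm hm7, show D.profile.sizes = D.sizes from rfl, sizes_count]
  exact Nat.le_sub_of_add_le (card_nclTraces_add_le hs hG h2 hm)

/-- The planes of the third kind with `|P ∩ ρ| = m`. -/
noncomputable def thirdPlanes (D : PLData M G) (m : ℕ) : Finset (Finset α) :=
  (planesR3 M G).filter fun P => P ≠ D.P₀ ∧ P ∉ D.piPlanes ∧ (P ∩ D.ρ).card = m

/-- A plane with a rank-`3` trace other than `P₀` and the `Π_y` is of the third kind. -/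
theorem third_spec (hs : Simple M) (hG : G ⊆ gr M) (h2 : 2 ≤ D.L.card) {P : Finset α} (hP : P ∈ planesR3 M G)
    (hne : P ≠ D.P₀) (hnPi : P ∉ D.piPlanes) :
    ∃ x ∈ D.L, P ∩ G = insert x (P ∩ D.ρ) ∧ M.eRk ((P ∩ D.ρ : Finset α) : Set α) = 2 ∧ P ∩ D.ρ ∉ D.classes := by
  obtain ⟨hP, hr3⟩ := mem_planesR3.1 hP
  rcases plane_trichotomy hs hG h2 hP hr3 with h | ⟨y, hy, h⟩ | h
  · exact absurd h hne
  · exact absurd (mem_piPlanes.2 ⟨y, hy, h.symm⟩) hnPi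
  · exact h

/-- **The planes of the third kind with `|P ∩ ρ| = m` number at most `n·ν_m`** (`2 ≤ m ≤ 7`): `P ↦ (x, P ∩ ρ)`
is injective, as `P = cl({x} ∪ (P ∩ ρ))`. -/
theorem card_thirdPlanes_le (hs : Simple M) (hG : G ⊆ gr M) (hpl : ∀ P ∈ planes M, (P ∩ G).card ≤ 7)
    (hg : 10 ≤ G.card) {m : ℕ} (hm : 2 ≤ m) (hm7 : m ≤ 7) :
    (D.thirdPlanes m).card ≤ D.L.card * PL.nu D.profile m := by
  have h2 : 2 ≤ D.L.card := by have := D.three_le_card_L (hpl _ D.plane) hg; omega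
  have hsub : D.thirdPlanes m ⊆
      (D.L ×ˢ D.nclTraces m).image (fun q : α × Finset α => clF M (insert q.1 q.2)) := by
    intro P hP
    obtain ⟨hP3, hne, hnPi, hcard⟩ := Finset.mem_filter.1 hP
    obtain ⟨x, hx, htr, hr2, hncl⟩ := third_spec hs hG h2 hP3 hne hnPi
    have hP' := (mem_planesR3.1 hP3).1
    rw [Finset.mem_image]
    refine ⟨(x, P ∩ D.ρ), ?_, ?_⟩
    · rw [Finset.mem_product]
      refine ⟨hx, ?_⟩
      unfold nclTraces
      rw [Finset.mem_filter, Finset.mem_image]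
      refine ⟨⟨clF M (P ∩ D.ρ), ?_, clF_inter_ρ_eq hG hP'⟩, hcard, hncl⟩
      exact (clF_mem_lines (Finset.inter_subset_right.trans (D.ρ_subset.trans hG)) hr2).1
    · dsimp only
      rw [← htr]
      exact (plane_eq_clF_trace hP' (mem_planesR3.1 hP3).2).symm
  calc (D.thirdPlanes m).card ≤ ((D.L ×ˢ D.nclTraces m).image
        (fun q : α × Finset α => clF M (insert q.1 q.2))).card := Finset.card_le_card hsub
    _ ≤ (D.L ×ˢ D.nclTraces m).card := Finset.card_image_le
    _ = D.L.card * (D.nclTraces m).card := Finset.card_product _ _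
    _ ≤ D.L.card * PL.nu D.profile m := Nat.mul_le_mul_left _ (card_nclTraces_le hs hG hpl hg hm hm7)

end PLData

end PercRepro.SixFour
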